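import Summits.QuantumFields.BalabanUV.Beta.GAN24.KernelPeriodisation

/-!
# G-an2-4 ∕ (CONV-C), route R7, junction (S)(α) — PART A2: COMPOSITION OF DECAYING KERNELS, INVARIANCE OF pv23's INFINITE-VOLUME
# INVERSE `limInv ℤ^{d+1} P` UNDER THE PERIOD LATTICE, AND `per M (limInv ℤ^{d+1} P) = (per M P)⁻¹`

G-an2-4 formalisation swarm `b2b-balaban-gan24-formalise-*`, leaf prover 06 (gen 40), CRUX TEAM (2), ruling «YM REDIRECT» (e34b3e0c; FREEZE (0)
honoured; INTENT «STEP-COVARIANCE-PERIODISE», HOME/CLAIMS.log 2026-08-21 l.34155).  PART A (`KernelPeriodisation`) proved that the periodisation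
`per M` of exponentially bounded kernels on the bond index set `K (d+1) N` of `ℤ^{d+1}` is multiplicative on `Mℤ^{d+1}`-invariant kernels.
THIS PART (0 sorry, 0 def, no cited fact):
 * §1 the composition `comp A B` of PART A: invariance under the period lattice (`comp_sh`; likewise road P2's pair-sum `sandwich_sh` and padding
   `padOp_sh`), the two-factor exponential bound `abs_comp_le` (`|comp A B| ≤ a·b·N·K_{d+1}(δ/2)·e^{−(δ/2)|·|}`), and road P2's pair-sum as the
   iterated composition `sandwich_eq_comp : sandwich C Δ = comp (trK C) (comp Δ C)` (`Summable.tsum_prod` on `summable_sandwich`);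
 * §2 **`limInv_sh`**: for a kernel `P` satisfying B4's (5.6) on all of `ℤ^{d+1}` (pv23's `Hyp56Z univ P γ c δ`) and INVARIANT under the period
   lattice, pv23's infinite-volume inverse kernel `limInv univ P` ([Balaban1983RegularityDecay] Sect. 5, the exhaustion limit) is invariant too —
   by pv23's UNIQUENESS of the bounded two-sided inverse `eq_limInv_of_left_inverse` applied to the shifted kernel;
 * §3 **`per_limInv_mul_per : per M (limInv univ P) * per M P = 1`** (PART A's `per_comp` + pv23's `tsum_limInv_mul` + `per_delta`) and
   **`per_limInv_eq_inv : per M (limInv univ P) = (per M P)⁻¹`** — the torus inverse of a periodised operator IS the periodised infinite-volume inverse.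
HONEST SCOPE.  [folklore] real analysis over pv23's kernel-checked Sect. 5 package (`B4Sect5Exhaustion`, p-accepted) BY NAME; hypotheses are explicit
decay ∕ invariance ∕ (5.6) binders asserted of nothing; nothing printed enters as a hypothesis (ABSOLUTE RULE).  Nothing of Bałaban's is instantiated
here (PARTS B∕C).  Moves NO (CONV-C) clause; NOT (CONV-C) as typed, NEVER «G-an2-4 closed», NOT NE2 ∕ NE3, NOT D1, NOT BetaPertH, NOT continuum, NOT
Clay — not in print; our bookkeeping.  HONEST DEPENDENCY: continuum YM on T⁴ ⇐ BetaPertH ∧ nine spine estimates (0/9 proved); BetaPertH ⇐ (D1) ∧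
(D4) ∧ CAP+tail; G-an2-4 gates asym, D1 and NE2/3/4.
-/

noncomputable section

open scoped BigOperators
open Finset Real Filter Topology

namespace Summit.QuantumFields.BalabanUV.Beta.GAN24.KernelPeriodisationInverse

open Literature.MathematicalPhysics.QuantumFieldTheory.Balaban1983to89
open B4Sect5Proof (cStar deltaStar cStar_pos deltaStar_pos latticeConst latticeConst_nonneg)
open B4Sect5Exhaustion (K Hyp56Z limInv limInv_abs_le tsum_limInv_mul eq_limInv_of_left_inverse summable_expKernel tsum_expKernel_le)
open B6Lemma24Torus (pbox)
open Summit.QuantumFields.BalabanUV.Beta.GAN24.DirichletExhaustionSandwich (sandwich summable_sandwich)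
open Summit.QuantumFields.BalabanUV.Beta.GAN24.DirichletExhaustionCovariance (trK)
open Summit.QuantumFields.BalabanUV.Beta.GAN24.DirichletExhaustionCovariancePad (padOp)
open Summit.QuantumFields.BalabanUV.Beta.GAN24.DirichletExhaustionQuadForm (amb)
open Summit.QuantumFields.BalabanUV.Beta.GAN24.KernelPeriodisation (sh shEquiv shEquiv_apply sh_eq_sh_iff comp per per_apply per_comp
  per_delta)

variable {d N : ℕ}

/-! ## §1 Composition of kernels: invariance, exponential bound, road P2's pair-sum -/

section Comp

variable {A B C Δ : K (d + 1) N → K (d + 1) N → ℝ} {a b α β cC c δ : ℝ}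

/-- the composition of two `Mℤ^{d+1}`-invariant kernels is invariant (re-indexing by the shift; no convergence needed). -/
theorem comp_sh (M : Fin (d + 1) → ℕ) (hA : ∀ m p q, A (sh M m p) (sh M m q) = A p q)
    (hB : ∀ m p q, B (sh M m p) (sh M m q) = B p q) (m : Fin (d + 1) → ℤ) (p q : K (d + 1) N) :
    comp A B (sh M m p) (sh M m q) = comp A B p q := by
  unfold comp
  rw [← (shEquiv (N := N) M m).tsum_eq fun r => A (sh M m p) r * B r (sh M m q)]
  refine tsum_congr fun r => ?_
  rw [shEquiv_apply, hA, hB]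

/-- road P2's pair-sum sandwich is invariant for an invariant middle kernel and an invariant `C`. -/
theorem sandwich_sh (M : Fin (d + 1) → ℕ) (hC : ∀ m p q, C (sh M m p) (sh M m q) = C p q)
    (hΔ : ∀ m p q, Δ (sh M m p) (sh M m q) = Δ p q) (m : Fin (d + 1) → ℤ) (p q : K (d + 1) N) :
    sandwich C Δ (sh M m p) (sh M m q) = sandwich C Δ p q := by
  unfold sandwich
  rw [← ((shEquiv (N := N) M m).prodCongr (shEquiv (N := N) M m)).tsum_eq
    fun x : K (d + 1) N × K (d + 1) N => C x.1 (sh M m p) * Δ x.1 x.2 * C x.2 (sh M m q)]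
  refine tsum_congr fun x => ?_
  simp only [Equiv.prodCongr_apply, Prod.map_fst, Prod.map_snd, shEquiv_apply]
  rw [hC, hΔ, hC]

/-- road P2's padding of an invariant kernel off an invariant free set is invariant. -/
theorem padOp_sh (M : Fin (d + 1) → ℕ) [∀ μ, NeZero (M μ)] {Free : K (d + 1) N → Prop} [DecidablePred Free]
    (hFree : ∀ m s, Free (sh M m s) ↔ Free s) (hA : ∀ m p q, A (sh M m p) (sh M m q) = A p q)
    (m : Fin (d + 1) → ℤ) (p q : K (d + 1) N) : padOp Free A (sh M m p) (sh M m q) = padOp Free A p q := by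
  unfold padOp
  simp only [hFree, hA, sh_eq_sh_iff]

/-- the two-factor chain: `e^{−δ|p−r|}e^{−δ|r−q|} ≤ e^{−(δ/2)|p−q|}·e^{−(δ/2)|p−r|}`. -/
theorem exp_two_chain_le (hδ : 0 ≤ δ) (p q r : Fin (d + 1) → ℤ) :
    Real.exp (-(δ * dist p r)) * Real.exp (-(δ * dist r q)) ≤ Real.exp (-(δ / 2 * dist p q)) * Real.exp (-(δ / 2 * dist p r)) := by
  rw [← Real.exp_add, ← Real.exp_add]
  apply Real.exp_le_exp.mpr
  have h1 : dist p q ≤ dist p r + dist r q := dist_triangle p r q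
  have h2 : 0 ≤ dist p r := dist_nonneg
  have h3 : 0 ≤ dist r q := dist_nonneg
  nlinarith [mul_le_mul_of_nonneg_left h1 hδ, mul_nonneg hδ h2, mul_nonneg hδ h3]

/-- termwise domination of the composition summand. -/
theorem abs_comp_term_le (hδ : 0 < δ) (ha : 0 ≤ a) (hA : ∀ p q : K (d + 1) N, |A p q| ≤ a * Real.exp (-(δ * dist p.1 q.1)))
    (hB : ∀ p q : K (d + 1) N, |B p q| ≤ b * Real.exp (-(δ * dist p.1 q.1))) (p q r : K (d + 1) N) :
    ‖A p r * B r q‖ ≤ a * b * Real.exp (-(δ / 2 * dist p.1 q.1)) * Real.exp (-(δ / 2 * dist p.1 r.1)) := by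
  have hb : 0 ≤ b := by
    have h := hB q q
    rw [dist_self, mul_zero, neg_zero, Real.exp_zero, mul_one] at h
    exact (abs_nonneg _).trans h
  rw [Real.norm_eq_abs, abs_mul]
  calc |A p r| * |B r q| ≤ a * Real.exp (-(δ * dist p.1 r.1)) * (b * Real.exp (-(δ * dist r.1 q.1))) :=
        mul_le_mul (hA p r) (hB r q) (abs_nonneg _) (by positivity)
    _ = a * b * (Real.exp (-(δ * dist p.1 r.1)) * Real.exp (-(δ * dist r.1 q.1))) := by ring
    _ ≤ a * b * (Real.exp (-(δ / 2 * dist p.1 q.1)) * Real.exp (-(δ / 2 * dist p.1 r.1))) :=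
        mul_le_mul_of_nonneg_left (exp_two_chain_le hδ.le p.1 q.1 r.1) (by positivity)
    _ = _ := by ring

/-- the composition summand is absolutely summable. -/
theorem summable_comp_term (hδ : 0 < δ) (ha : 0 ≤ a) (hA : ∀ p q : K (d + 1) N, |A p q| ≤ a * Real.exp (-(δ * dist p.1 q.1)))
    (hB : ∀ p q : K (d + 1) N, |B p q| ≤ b * Real.exp (-(δ * dist p.1 q.1))) (p q : K (d + 1) N) :
    Summable fun r : K (d + 1) N => A p r * B r q :=
  ((summable_expKernel (half_pos hδ) p.1).mul_left (a * b * Real.exp (-(δ / 2 * dist p.1 q.1)))).of_norm_bounded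
    (abs_comp_term_le hδ ha hA hB p q)

/-- **the composition of two exponentially bounded kernels is exponentially bounded**:
`|comp A B p q| ≤ a·b·N·K_{d+1}(δ/2)·e^{−(δ/2)|p−q|}`. [folklore] -/
theorem abs_comp_le (hδ : 0 < δ) (ha : 0 ≤ a) (hA : ∀ p q : K (d + 1) N, |A p q| ≤ a * Real.exp (-(δ * dist p.1 q.1)))
    (hB : ∀ p q : K (d + 1) N, |B p q| ≤ b * Real.exp (-(δ * dist p.1 q.1))) (p q : K (d + 1) N) :
    |comp A B p q| ≤ a * b * (N * latticeConst (d + 1) (δ / 2)) * Real.exp (-(δ / 2 * dist p.1 q.1)) := by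
  have hb : 0 ≤ b := by
    have h := hB q q
    rw [dist_self, mul_zero, neg_zero, Real.exp_zero, mul_one] at h
    exact (abs_nonneg _).trans h
  set W : ℝ := a * b * Real.exp (-(δ / 2 * dist p.1 q.1)) with hW
  have hs := (summable_expKernel (N := N) (half_pos hδ) p.1).mul_left W
  have h := tsum_of_norm_bounded hs.hasSum (abs_comp_term_le hδ ha hA hB p q)
  rw [Real.norm_eq_abs] at h
  refine h.trans ?_
  rw [tsum_mul_left]
  have hW0 : 0 ≤ W := by positivity
  calc W * ∑' r : K (d + 1) N, Real.exp (-(δ / 2 * dist p.1 r.1)) ≤ W * (N * latticeConst (d + 1) (δ / 2)) :=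
        mul_le_mul_of_nonneg_left (tsum_expKernel_le (half_pos hδ) p.1) hW0
    _ = _ := by rw [hW]; ring

/-- **road P2's pair-sum sandwich is the iterated composition**: `sandwich C Δ p q = comp (trK C) (comp Δ C) p q`
(Fubini on `summable_sandwich`). [folklore] -/
theorem sandwich_eq_comp (hδ : 0 < δ) (hcC : 0 ≤ cC) (hC : ∀ r p : K (d + 1) N, |C r p| ≤ cC * Real.exp (-(δ * dist r.1 p.1)))
    (hΔ : ∀ r s : K (d + 1) N, |Δ r s| ≤ c * Real.exp (-(δ * dist r.1 s.1))) (p q : K (d + 1) N) :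
    sandwich C Δ p q = comp (trK C) (comp Δ C) p q := by
  unfold sandwich comp trK
  rw [(summable_sandwich hδ hcC hC hΔ p q).tsum_prod]
  refine tsum_congr fun r => ?_
  rw [← tsum_mul_left]
  refine tsum_congr fun s => ?_
  ring

end Comp

/-! ## §2 pv23's infinite-volume inverse of an invariant operator is invariant -/

section Inverse

variable (M : Fin (d + 1) → ℕ) [∀ μ, NeZero (M μ)]
variable {P : K (d + 1) N → K (d + 1) N → ℝ} {γ c δ : ℝ}

omit [∀ μ, NeZero (M μ)] in
/-- **`limInv_sh`**: if `P` satisfies B4's (5.6) on all of `ℤ^{d+1}` and is invariant under the diagonal action of the period lattice, so is pv23's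
infinite-volume inverse kernel `limInv univ P` — the shifted kernel is another bounded left inverse, and the bounded two-sided inverse is UNIQUE
(`B4Sect5Exhaustion.eq_limInv_of_left_inverse`). [folklore] -/
theorem limInv_sh (hγ : 0 < γ) (hc : 0 < c) (hδ : 0 < δ) (hP : Hyp56Z (Set.univ : Set (Fin (d + 1) → ℤ)) P γ c δ)
    (hPinv : ∀ m p q, P (sh M m p) (sh M m q) = P p q) (m : Fin (d + 1) → ℤ) (p q : K (d + 1) N) :
    limInv Set.univ P (sh M m p) (sh M m q) = limInv Set.univ P p q := by
  refine eq_limInv_of_left_inverse hγ hc hδ hP (D := fun p q => limInv Set.univ P (sh M m p) (sh M m q))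
    (M := cStar (d + 1) N γ c δ) (fun p' q' => ?_) (fun p' q' hq' => absurd (Set.mem_univ _) hq') (fun p' r' _ _ => ?_)
    (Set.mem_univ _) (Set.mem_univ _)
  · refine (limInv_abs_le hγ hc hδ hP _ _).trans ?_
    have hε : Real.exp (-(deltaStar (d + 1) N γ c δ * dist (sh M m p').1 (sh M m q').1)) ≤ 1 :=
      Real.exp_le_one_iff.mpr (neg_nonpos.mpr (mul_nonneg (deltaStar_pos (d + 1) N hγ hc.le hδ).le dist_nonneg))
    exact mul_le_of_le_one_right (cStar_pos (d + 1) N c δ hγ).le hε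
  · have h1 : ∀ q', limInv Set.univ P (sh M m p') (sh M m q') * P q' r'
        = limInv Set.univ P (sh M m p') (sh M m q') * P (sh M m q') (sh M m r') := fun q' => by rw [hPinv]
    simp_rw [h1]
    have h2 : ∑' q', limInv Set.univ P (sh M m p') (sh M m q') * P (sh M m q') (sh M m r')
        = ∑' q', limInv Set.univ P (sh M m p') q' * P q' (sh M m r') :=
      (shEquiv (N := N) M m).tsum_eq fun q' => limInv Set.univ P (sh M m p') q' * P q' (sh M m r')
    rw [h2, tsum_limInv_mul hγ hc hδ hP (Set.mem_univ _) (Set.mem_univ _)]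
    simp only [sh_eq_sh_iff]

/-! ## §3 The torus inverse of a periodised operator is the periodised infinite-volume inverse -/

/-- **`per M (limInv univ P) * per M P = 1`**: PART A's `per_comp` (`limInv` decays at `(cStar, deltaStar)`, `P` at `(c, δ)`, `P` invariant) and pv23's
left-inverse identity `tsum_limInv_mul` (`comp (limInv univ P) P = δ`), `per_delta`. [folklore] -/
theorem per_limInv_mul_per (hγ : 0 < γ) (hc : 0 < c) (hδ : 0 < δ) (hP : Hyp56Z (Set.univ : Set (Fin (d + 1) → ℤ)) P γ c δ)
    (hPinv : ∀ m p q, P (sh M m p) (sh M m q) = P p q) :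
    per M (limInv Set.univ P) * per M P = 1 := by
  have hdecP : ∀ p q : K (d + 1) N, |P p q| ≤ c * Real.exp (-(δ * dist p.1 q.1)) :=
    fun p q => hP.decay p q (Set.mem_univ _) (Set.mem_univ _)
  rw [← per_comp M (deltaStar_pos (d + 1) N hγ hc.le hδ) hδ (cStar_pos (d + 1) N c δ hγ).le hc.le
    (limInv_abs_le hγ hc hδ hP) hdecP hPinv]
  have hcomp : comp (limInv Set.univ P) P = fun p q : K (d + 1) N => if p = q then (1 : ℝ) else 0 := by
    funext p q
    exact tsum_limInv_mul hγ hc hδ hP (Set.mem_univ _) (Set.mem_univ _)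
  rw [hcomp, per_delta]

/-- **`per M (limInv univ P) = (per M P)⁻¹`** — the torus-box inverse of the periodisation of an invariant (5.6)-operator on `ℤ^{d+1}` is the
periodisation of its infinite-volume inverse. [folklore] -/
theorem per_limInv_eq_inv (hγ : 0 < γ) (hc : 0 < c) (hδ : 0 < δ) (hP : Hyp56Z (Set.univ : Set (Fin (d + 1) → ℤ)) P γ c δ)
    (hPinv : ∀ m p q, P (sh M m p) (sh M m q) = P p q) :
    per M (limInv Set.univ P) = (per M P)⁻¹ :=
  (Matrix.inv_eq_left_inv (per_limInv_mul_per M hγ hc hδ hP hPinv)).symm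

/-- … so the periodised operator is invertible on the torus box, with two-sided inverse the periodised infinite-volume inverse. -/
theorem per_mul_per_limInv (hγ : 0 < γ) (hc : 0 < c) (hδ : 0 < δ) (hP : Hyp56Z (Set.univ : Set (Fin (d + 1) → ℤ)) P γ c δ)
    (hPinv : ∀ m p q, P (sh M m p) (sh M m q) = P p q) :
    per M P * per M (limInv Set.univ P) = 1 := by
  exact mul_eq_one_comm.1 (per_limInv_mul_per M hγ hc hδ hP hPinv)

end Inverse

end Summit.QuantumFields.BalabanUV.Beta.GAN24.KernelPeriodisationInverse

end
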